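import Literature.Analysis.FluidPDE.AxisDistancePowerIntegral
import Summits.NavierStokesRegularity.NavierStokesRegularity.Theorems.GaldiLiouvilleGateAllAxesRayDecay
import HarnessLib

/-!
# All-axes cylinder budget, piece O1a″ (2/3): the ray inequality in cylindrical coordinates

Helper toward obligation O1a″ `CylinderDecayOfHessian` of the «all-axes cylinder budget» line for
`GaldiLiouvilleGate.GaldiLiouville` (stmt-NavierStokesRegularity-0895; Defs of record
`CylinderBudgets_v3_1.lean` 817120c4c833a18a). For `P ∈ C²(ℝ³)` with `P → c` at infinity:

* along every ray `σ ↦ σ•v + w`, `‖v‖ = 1`: `|P(s v + w) − c| ≤ ∫_{σ>s} σ ‖D²P(σ v + w)‖ dσ`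
  (`ofReal_abs_sub_le_lintegral_ray`, from piece 1/3);
* integrating over the directions `v = (cos θ, sin θ, 0)` and heights `w = (0,0,z)` with the
  cylindrical volume element `ρ dρ dθ dz` (`Literature…lintegral_eq_lintegral_cylindrical`):
  `∫_{R<r<2R} |P − c| ≤ (3R²/2) ∫_{r>R} ‖D²P‖` (`shell_lintegral_abs_sub_le`) and
  `∫_{r<R} |P − c| ≤ (R²/2) ∫ ‖D²P‖` (`solid_lintegral_abs_sub_le`), `r = cylRadius`.

This is the blueprint step «`∬|P−c|(r,·)dθdz ≤ ‖∇²P‖_{L¹(cylRadius>r)}`» (Wang 2025, proof of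
Lemma 3.5, p. 50). Theorems only, standard axioms, no `sorry`.

WHAT THIS IS NOT: not a proof of ⟨0895⟩/⟨0896⟩ nor of any NS regularity statement.
-/

set_option linter.dupNamespace false

noncomputable section

open MeasureTheory Set Filter Topology
open scoped ENNReal Topology
open Literature.Analysis.FluidPDE

namespace Summit.NavierStokesRegularity.NavierStokesRegularity.Theorems.GaldiLiouville.AllAxesBudget

/-! ### Rays `σ ↦ σ • v + w` -/

section Ray

variable {E : Type*} [NormedAddCommGroup E] [NormedSpace ℝ E] {P : E → ℝ}

/-- The derivative of a map `Q` along the ray `σ ↦ σ•v + w`. [folklore] -/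
theorem hasDerivAt_ray {F : Type*} [NormedAddCommGroup F] [NormedSpace ℝ F] {Q : E → F}
    (hQ : Differentiable ℝ Q) (v w : E) (τ : ℝ) :
    HasDerivAt (fun τ : ℝ => Q (τ • v + w)) (fderiv ℝ Q (τ • v + w) v) τ := by
  have hl : HasDerivAt (fun τ : ℝ => τ • v + w) v τ := by
    simpa using ((hasDerivAt_id τ).smul_const v).add_const w
  exact (hQ (τ • v + w)).hasFDerivAt.comp_hasDerivAt τ hl

/-- The second derivative of `P ∈ C²` along the ray `σ ↦ σ•v + w` is `D²P(σ v + w)(v, v)`.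
[folklore] -/
theorem deriv_deriv_ray (hP : ContDiff ℝ 2 P) (v w : E) (τ : ℝ) :
    deriv (deriv fun τ : ℝ => P (τ • v + w)) τ = iteratedFDeriv ℝ 2 P (τ • v + w) ![v, v] := by
  have hPd : Differentiable ℝ P := hP.differentiable (by norm_num)
  have hP1 : ContDiff ℝ 1 (fderiv ℝ P) := hP.fderiv_right (by rw [one_add_one_eq_two])
  have hP1d : Differentiable ℝ (fderiv ℝ P) := hP1.differentiable one_ne_zero
  have h1 : deriv (fun τ : ℝ => P (τ • v + w)) = fun τ => fderiv ℝ P (τ • v + w) v := by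
    funext τ; exact (hasDerivAt_ray hPd v w τ).deriv
  rw [h1]
  have h2 : HasDerivAt (fun τ : ℝ => fderiv ℝ P (τ • v + w))
      (fderiv ℝ (fderiv ℝ P) (τ • v + w) v) τ :=
    hasDerivAt_ray (Q := fderiv ℝ P) hP1d v w τ
  have h3 := h2.clm_apply (hasDerivAt_const τ v)
  rw [h3.deriv, iteratedFDeriv_two_apply]
  simp

/-- `|d²/dσ² P(σ v + w)| ≤ ‖D²P(σ v + w)‖` for a unit direction `v`. [folklore] -/
theorem abs_deriv_deriv_ray_le (hP : ContDiff ℝ 2 P) {v : E} (hv : ‖v‖ = 1) (w : E) (τ : ℝ) :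
    |deriv (deriv fun τ : ℝ => P (τ • v + w)) τ| ≤ ‖iteratedFDeriv ℝ 2 P (τ • v + w)‖ := by
  rw [deriv_deriv_ray hP v w τ, ← Real.norm_eq_abs]
  refine (ContinuousMultilinearMap.le_opNorm _ _).trans ?_
  rw [Fin.prod_univ_two]
  simp [hv]

/-- A ray with unit direction leaves every compact set. [folklore] -/
theorem tendsto_ray_cocompact {v : E} (hv : ‖v‖ = 1) (w : E) :
    Tendsto (fun σ : ℝ => σ • v + w) atTop (cocompact E) := by
  refine tendsto_cocompact_of_tendsto_dist_comp_atTop (0 : E) ?_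
  have hb : ∀ σ : ℝ, σ + -‖w‖ ≤ dist (σ • v + w) 0 := by
    intro σ
    rw [dist_zero_right]
    have h1 : ‖σ • v‖ = |σ| := by rw [norm_smul, hv, mul_one, Real.norm_eq_abs]
    have h2 : ‖σ • v‖ ≤ ‖σ • v + w‖ + ‖w‖ := by
      have := norm_sub_le (σ • v + w) w
      rwa [add_sub_cancel_right] at this
    linarith [le_abs_self σ]
  exact tendsto_atTop_mono hb (tendsto_atTop_add_const_right _ _ tendsto_id)

/-- **Ray inequality.** For `P ∈ C²` with `P → c` at infinity, a unit direction `v` and `s > 0`: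
`|P(s v + w) − c| ≤ ∫_{σ>s} σ ‖D²P(σ v + w)‖ dσ` in `[0, ∞]`. [cite: Wang2025, Lemma 3.5 (proof, p. 50)] -/
theorem ofReal_abs_sub_le_lintegral_ray (hP : ContDiff ℝ 2 P) {c : ℝ}
    (hPc : Tendsto P (cocompact E) (𝓝 c)) {v : E} (hv : ‖v‖ = 1) (w : E) {s : ℝ} (hs : 0 < s) :
    ENNReal.ofReal |P (s • v + w) - c| ≤
      ∫⁻ σ in Ioi s, ENNReal.ofReal σ * ENNReal.ofReal ‖iteratedFDeriv ℝ 2 P (σ • v + w)‖ := by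
  have hf : ContDiff ℝ 2 (fun τ : ℝ => P (τ • v + w)) :=
    hP.comp ((contDiff_id.smul contDiff_const).add contDiff_const)
  have hlim : Tendsto (fun τ : ℝ => P (τ • v + w)) atTop (𝓝 c) :=
    hPc.comp (tendsto_ray_cocompact hv w)
  refine (ofReal_abs_sub_lim_le_lintegral_mul_deriv_two hf hs hlim).trans
    (setLIntegral_mono' measurableSet_Ioi fun σ hσ => ?_)
  have hσ : 0 ≤ σ := hs.le.trans (le_of_lt hσ)
  rw [← ENNReal.ofReal_mul hσ]
  exact ENNReal.ofReal_le_ofReal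
    (mul_le_mul_of_nonneg_left (abs_deriv_deriv_ray_le hP hv w σ) hσ)

end Ray

/-! ### Cylindrical coordinates about the `x₃`-axis -/

/-- The cylindrical point `(ρ cos θ, ρ sin θ, z)` lies on the ray `ρ ↦ ρ•(cos θ, sin θ, 0) + (0, 0, z)`.
[folklore] -/
theorem cylPt_eq_ray (ρ θ z : ℝ) :
    (WithLp.toLp 2 ![ρ * Real.cos θ, ρ * Real.sin θ, z] : EuclideanSpace ℝ (Fin 3)) =
      ρ • (WithLp.toLp 2 ![Real.cos θ, Real.sin θ, 0] : EuclideanSpace ℝ (Fin 3)) +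
        WithLp.toLp 2 ![0, 0, z] := by
  ext i
  fin_cases i <;> simp

/-- The direction `(cos θ, sin θ, 0)` is a unit vector. [folklore] -/
theorem norm_cylDir (θ : ℝ) :
    ‖(WithLp.toLp 2 ![Real.cos θ, Real.sin θ, 0] : EuclideanSpace ℝ (Fin 3))‖ = 1 := by
  rw [EuclideanSpace.norm_eq, Fin.sum_univ_three]
  simp only [Matrix.cons_val_zero, Matrix.cons_val_one, Matrix.cons_val,
    Real.norm_eq_abs, sq_abs]
  rw [Real.cos_sq_add_sin_sq]
  simp

variable {P : EuclideanSpace ℝ (Fin 3) → ℝ} {c : ℝ}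

/-- `∫_{(a,b)} ρ dρ = (b² − a²)/2` as a lower Lebesgue integral, `0 ≤ a ≤ b`. [folklore] -/
theorem lintegral_Ioo_ofReal_id {a b : ℝ} (ha : 0 ≤ a) (hab : a ≤ b) :
    ∫⁻ ρ in Ioo a b, ENNReal.ofReal ρ = ENNReal.ofReal ((b ^ 2 - a ^ 2) / 2) := by
  have hint : IntegrableOn (fun ρ : ℝ => ρ) (Ioo a b) :=
    (continuous_id.integrableOn_Icc (a := a) (b := b)).mono_set Ioo_subset_Icc_self
  rw [← ofReal_integral_eq_lintegral_ofReal hint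
    ((ae_restrict_iff' measurableSet_Ioo).2 (ae_of_all _ fun ρ hρ => ha.trans hρ.1.le))]
  congr 1
  rw [← integral_Ioc_eq_integral_Ioo, ← intervalIntegral.integral_of_le hab, integral_id]

/-- **Shell/solid bookkeeping along one cylindrical direction.** For `0 ≤ a ≤ b` and fixed `(θ, z)`:
`∫_{a<ρ<b} ρ|P(ρ,θ,z) − c| dρ ≤ ((b²−a²)/2) ∫_{σ>a} σ‖D²P(σ,θ,z)‖ dσ`. [cite: Wang2025, Lemma 3.5 (proof, p. 50)] -/
theorem lintegral_indicator_Ioo_abs_sub_le (hP : ContDiff ℝ 2 P)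
    (hPc : Tendsto P (cocompact (EuclideanSpace ℝ (Fin 3))) (𝓝 c)) (θ z : ℝ) {a b : ℝ}
    (ha : 0 ≤ a) (hab : a ≤ b) :
    ∫⁻ ρ in Ioi (0 : ℝ), (Ioo a b).indicator (fun ρ => ENNReal.ofReal ρ *
        ENNReal.ofReal |P (WithLp.toLp 2 ![ρ * Real.cos θ, ρ * Real.sin θ, z]) - c|) ρ ≤
      ENNReal.ofReal ((b ^ 2 - a ^ 2) / 2) * ∫⁻ σ in Ioi a, ENNReal.ofReal σ *
        ENNReal.ofReal ‖iteratedFDeriv ℝ 2 P (WithLp.toLp 2 ![σ * Real.cos θ, σ * Real.sin θ, z])‖ := by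
  set J : ℝ≥0∞ := ∫⁻ σ in Ioi a, ENNReal.ofReal σ *
    ENNReal.ofReal ‖iteratedFDeriv ℝ 2 P (WithLp.toLp 2 ![σ * Real.cos θ, σ * Real.sin θ, z])‖ with hJ
  -- pointwise: the ray inequality, then enlarge `Ioi ρ` to `Ioi a`
  have hpt : ∀ ρ, (Ioo a b).indicator (fun ρ => ENNReal.ofReal ρ *
      ENNReal.ofReal |P (WithLp.toLp 2 ![ρ * Real.cos θ, ρ * Real.sin θ, z]) - c|) ρ ≤
      (Ioo a b).indicator (fun ρ => ENNReal.ofReal ρ * J) ρ := by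
    intro ρ
    by_cases hρ : ρ ∈ Ioo a b
    · rw [indicator_of_mem hρ, indicator_of_mem hρ]
      have hρ0 : 0 < ρ := ha.trans_lt hρ.1
      refine mul_le_mul' le_rfl ?_
      have h := ofReal_abs_sub_le_lintegral_ray hP hPc (norm_cylDir θ) (WithLp.toLp 2 ![0, 0, z]) hρ0
      simp only [← cylPt_eq_ray] at h
      exact h.trans (lintegral_mono_set (Ioi_subset_Ioi hρ.1.le))
    · rw [indicator_of_notMem hρ, indicator_of_notMem hρ]
  refine (lintegral_mono hpt).trans ?_
  have hset : Ioo a b ∩ Ioi (0 : ℝ) = Ioo a b := inter_eq_left.2 fun ρ hρ => ha.trans_lt hρ.1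
  rw [lintegral_indicator measurableSet_Ioo, Measure.restrict_restrict measurableSet_Ioo, hset,
    lintegral_mul_const _ ENNReal.measurable_ofReal, lintegral_Ioo_ofReal_id ha hab, mul_comm]

/-- The cylindrical representation of `∫_{σ > a} σ‖D²P‖` restricted to `ρ > 0`, `0 ≤ a`. [folklore] -/
theorem lintegral_Ioi_indicator_eq {g : EuclideanSpace ℝ (Fin 3) → ℝ≥0∞} (θ z : ℝ) {a : ℝ} (ha : 0 ≤ a) :
    ∫⁻ ρ in Ioi (0 : ℝ), ENNReal.ofReal ρ *
        {x : EuclideanSpace ℝ (Fin 3) | a < cylRadius x}.indicator g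
          (WithLp.toLp 2 ![ρ * Real.cos θ, ρ * Real.sin θ, z]) =
      ∫⁻ σ in Ioi a, ENNReal.ofReal σ * g (WithLp.toLp 2 ![σ * Real.cos θ, σ * Real.sin θ, z]) := by
  have h1 : ∫⁻ ρ in Ioi (0 : ℝ), ENNReal.ofReal ρ *
        {x : EuclideanSpace ℝ (Fin 3) | a < cylRadius x}.indicator g
          (WithLp.toLp 2 ![ρ * Real.cos θ, ρ * Real.sin θ, z]) =
      ∫⁻ ρ in Ioi (0 : ℝ), (Ioi a).indicator
        (fun σ => ENNReal.ofReal σ * g (WithLp.toLp 2 ![σ * Real.cos θ, σ * Real.sin θ, z])) ρ := by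
    refine setLIntegral_congr_fun measurableSet_Ioi fun ρ hρ => ?_
    have hρ0 : (0 : ℝ) < ρ := hρ
    have hcr : cylRadius (WithLp.toLp 2 ![ρ * Real.cos θ, ρ * Real.sin θ, z] : EuclideanSpace ℝ (Fin 3)) = ρ := by
      -- (the tree's `cylRadius_cylPt` lives in a route cone; recomputed inline)
      rw [cylRadius]
      have e : (ρ * Real.cos θ) ^ 2 + (ρ * Real.sin θ) ^ 2 = ρ ^ 2 := by
        linear_combination ρ ^ 2 * Real.sin_sq_add_cos_sq θ
      simp only [Matrix.cons_val_zero, Matrix.cons_val_one]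
      rw [e, Real.sqrt_sq hρ0.le]
    have hmem : ((WithLp.toLp 2 ![ρ * Real.cos θ, ρ * Real.sin θ, z] : EuclideanSpace ℝ (Fin 3)) ∈
        {x : EuclideanSpace ℝ (Fin 3) | a < cylRadius x}) ↔ ρ ∈ Ioi a := by
      rw [mem_setOf_eq, hcr, mem_Ioi]
    by_cases h : ρ ∈ Ioi a
    · rw [indicator_of_mem (hmem.2 h), indicator_of_mem h]
    · rw [indicator_of_notMem (fun h' => h (hmem.1 h')), indicator_of_notMem h, mul_zero]
  have hset : Ioi a ∩ Ioi (0 : ℝ) = Ioi a := inter_eq_left.2 (Ioi_subset_Ioi ha)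
  rw [h1, lintegral_indicator measurableSet_Ioi, Measure.restrict_restrict measurableSet_Ioi, hset]

/-- **Shell estimate.** `∫_{R < r < 2R} |P − c| dx ≤ (3R²/2) ∫_{r > R} ‖D²P‖ dx` (`r` = distance to
the `x₃`-axis), for `P ∈ C²(ℝ³)` with `P → c` at infinity and `R > 0`. [cite: Wang2025, Lemma 3.5 (proof, p. 50)] -/
theorem shell_lintegral_abs_sub_le (hP : ContDiff ℝ 2 P)
    (hPc : Tendsto P (cocompact (EuclideanSpace ℝ (Fin 3))) (𝓝 c)) {R : ℝ} (hR : 0 < R) :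
    ∫⁻ x in {x : EuclideanSpace ℝ (Fin 3) | R < cylRadius x ∧ cylRadius x < 2 * R},
        ENNReal.ofReal |P x - c| ≤
      ENNReal.ofReal (3 * R ^ 2 / 2) *
        ∫⁻ x in {x : EuclideanSpace ℝ (Fin 3) | R < cylRadius x},
          ENNReal.ofReal ‖iteratedFDeriv ℝ 2 P x‖ := by
  have hm : Measurable (cylRadius : EuclideanSpace ℝ (Fin 3) → ℝ) := continuous_cylRadius.measurable
  have hS : MeasurableSet {x : EuclideanSpace ℝ (Fin 3) | R < cylRadius x ∧ cylRadius x < 2 * R} :=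
    (measurableSet_lt measurable_const hm).inter (measurableSet_lt hm measurable_const)
  have hT : MeasurableSet {x : EuclideanSpace ℝ (Fin 3) | R < cylRadius x} :=
    measurableSet_lt measurable_const hm
  have hF : Measurable fun x => ENNReal.ofReal |P x - c| :=
    ENNReal.measurable_ofReal.comp ((hP.continuous.sub continuous_const).abs).measurable
  have hG : Measurable fun x => ENNReal.ofReal ‖iteratedFDeriv ℝ 2 P x‖ :=
    ENNReal.measurable_ofReal.comp (hP.continuous_iteratedFDeriv le_rfl).norm.measurable
  rw [← lintegral_indicator hS, lintegral_eq_lintegral_cylindrical (hF.indicator hS),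
    ← lintegral_indicator hT, lintegral_eq_lintegral_cylindrical (hG.indicator hT),
    ← lintegral_const_mul' _ _ ENNReal.ofReal_ne_top]
  refine lintegral_mono fun z => ?_
  rw [← lintegral_const_mul' _ _ ENNReal.ofReal_ne_top]
  refine lintegral_mono fun θ => ?_
  rw [lintegral_Ioi_indicator_eq θ z hR.le]
  -- the inner integrand is the `Ioo R (2R)`-indicator of `ρ |P − c|`
  have h1 : ∫⁻ ρ in Ioi (0 : ℝ), ENNReal.ofReal ρ *
        {x : EuclideanSpace ℝ (Fin 3) | R < cylRadius x ∧ cylRadius x < 2 * R}.indicator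
          (fun x => ENNReal.ofReal |P x - c|) (WithLp.toLp 2 ![ρ * Real.cos θ, ρ * Real.sin θ, z]) =
      ∫⁻ ρ in Ioi (0 : ℝ), (Ioo R (2 * R)).indicator (fun ρ => ENNReal.ofReal ρ *
        ENNReal.ofReal |P (WithLp.toLp 2 ![ρ * Real.cos θ, ρ * Real.sin θ, z]) - c|) ρ := by
    refine setLIntegral_congr_fun measurableSet_Ioi fun ρ hρ => ?_
    have hρ0 : (0 : ℝ) < ρ := hρ
    have hcr : cylRadius (WithLp.toLp 2 ![ρ * Real.cos θ, ρ * Real.sin θ, z] : EuclideanSpace ℝ (Fin 3)) = ρ := by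
      -- (the tree's `cylRadius_cylPt` lives in a route cone; recomputed inline)
      rw [cylRadius]
      have e : (ρ * Real.cos θ) ^ 2 + (ρ * Real.sin θ) ^ 2 = ρ ^ 2 := by
        linear_combination ρ ^ 2 * Real.sin_sq_add_cos_sq θ
      simp only [Matrix.cons_val_zero, Matrix.cons_val_one]
      rw [e, Real.sqrt_sq hρ0.le]
    have hmem : ((WithLp.toLp 2 ![ρ * Real.cos θ, ρ * Real.sin θ, z] : EuclideanSpace ℝ (Fin 3)) ∈
        {x : EuclideanSpace ℝ (Fin 3) | R < cylRadius x ∧ cylRadius x < 2 * R}) ↔ ρ ∈ Ioo R (2 * R) := by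
      rw [mem_setOf_eq, hcr, mem_Ioo]
    by_cases h : ρ ∈ Ioo R (2 * R)
    · rw [indicator_of_mem (hmem.2 h), indicator_of_mem h]
    · rw [indicator_of_notMem (fun h' => h (hmem.1 h')), indicator_of_notMem h, mul_zero]
  rw [h1]
  refine (lintegral_indicator_Ioo_abs_sub_le hP hPc θ z hR.le (by linarith)).trans (le_of_eq ?_)
  congr 2
  ring

/-- **Solid-cylinder estimate.** `∫_{r < R} |P − c| dx ≤ (R²/2) ∫_{ℝ³} ‖D²P‖ dx`, for `P ∈ C²(ℝ³)`
with `P → c` at infinity and `R ≥ 0`. [cite: Wang2025, Lemma 3.5 (proof, p. 50)] -/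
theorem solid_lintegral_abs_sub_le (hP : ContDiff ℝ 2 P)
    (hPc : Tendsto P (cocompact (EuclideanSpace ℝ (Fin 3))) (𝓝 c)) {R : ℝ} (hR : 0 ≤ R) :
    ∫⁻ x in {x : EuclideanSpace ℝ (Fin 3) | cylRadius x < R}, ENNReal.ofReal |P x - c| ≤
      ENNReal.ofReal (R ^ 2 / 2) * ∫⁻ x, ENNReal.ofReal ‖iteratedFDeriv ℝ 2 P x‖ := by
  have hm : Measurable (cylRadius : EuclideanSpace ℝ (Fin 3) → ℝ) := continuous_cylRadius.measurable
  have hS : MeasurableSet {x : EuclideanSpace ℝ (Fin 3) | cylRadius x < R} :=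
    measurableSet_lt hm measurable_const
  have hF : Measurable fun x => ENNReal.ofReal |P x - c| :=
    ENNReal.measurable_ofReal.comp ((hP.continuous.sub continuous_const).abs).measurable
  have hG : Measurable fun x => ENNReal.ofReal ‖iteratedFDeriv ℝ 2 P x‖ :=
    ENNReal.measurable_ofReal.comp (hP.continuous_iteratedFDeriv le_rfl).norm.measurable
  rw [← lintegral_indicator hS, lintegral_eq_lintegral_cylindrical (hF.indicator hS),
    lintegral_eq_lintegral_cylindrical hG, ← lintegral_const_mul' _ _ ENNReal.ofReal_ne_top]
  refine lintegral_mono fun z => ?_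
  rw [← lintegral_const_mul' _ _ ENNReal.ofReal_ne_top]
  refine lintegral_mono fun θ => ?_
  have h1 : ∫⁻ ρ in Ioi (0 : ℝ), ENNReal.ofReal ρ *
        {x : EuclideanSpace ℝ (Fin 3) | cylRadius x < R}.indicator
          (fun x => ENNReal.ofReal |P x - c|) (WithLp.toLp 2 ![ρ * Real.cos θ, ρ * Real.sin θ, z]) =
      ∫⁻ ρ in Ioi (0 : ℝ), (Ioo 0 R).indicator (fun ρ => ENNReal.ofReal ρ *
        ENNReal.ofReal |P (WithLp.toLp 2 ![ρ * Real.cos θ, ρ * Real.sin θ, z]) - c|) ρ := by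
    refine setLIntegral_congr_fun measurableSet_Ioi fun ρ hρ => ?_
    have hρ0 : (0 : ℝ) < ρ := hρ
    have hcr : cylRadius (WithLp.toLp 2 ![ρ * Real.cos θ, ρ * Real.sin θ, z] : EuclideanSpace ℝ (Fin 3)) = ρ := by
      -- (the tree's `cylRadius_cylPt` lives in a route cone; recomputed inline)
      rw [cylRadius]
      have e : (ρ * Real.cos θ) ^ 2 + (ρ * Real.sin θ) ^ 2 = ρ ^ 2 := by
        linear_combination ρ ^ 2 * Real.sin_sq_add_cos_sq θ
      simp only [Matrix.cons_val_zero, Matrix.cons_val_one]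
      rw [e, Real.sqrt_sq hρ0.le]
    have hmem : ((WithLp.toLp 2 ![ρ * Real.cos θ, ρ * Real.sin θ, z] : EuclideanSpace ℝ (Fin 3)) ∈
        {x : EuclideanSpace ℝ (Fin 3) | cylRadius x < R}) ↔ ρ ∈ Ioo 0 R := by
      rw [mem_setOf_eq, hcr, mem_Ioo]
      exact ⟨fun h => ⟨hρ0, h⟩, fun h => h.2⟩
    by_cases h : ρ ∈ Ioo 0 R
    · rw [indicator_of_mem (hmem.2 h), indicator_of_mem h]
    · rw [indicator_of_notMem (fun h' => h (hmem.1 h')), indicator_of_notMem h, mul_zero]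
  rw [h1]
  refine (lintegral_indicator_Ioo_abs_sub_le hP hPc θ z le_rfl hR).trans (le_of_eq ?_)
  congr 2
  ring

end Summit.NavierStokesRegularity.NavierStokesRegularity.Theorems.GaldiLiouville.AllAxesBudget

end
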